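import Literature.Probability.LatticeModels.LatticeGreenGradient
import Literature.MathematicalPhysics.QuantumFieldTheory.Balaban1983to89.B4Eq19LatticeOperators
import HarnessLib

/-!
# Line «sandwich_discharge» on crux `HistoryTailL` (stmt-QuantumFields-19936), stub `stub_sandwichSweepGapCapped` (S′), brick B5 on `ℤ³` —
# «THE FREE GREEN KERNEL'S DIFFERENCE BOUNDS IN BOX LANGUAGE»: the hypotheses of ✓`CovariantDischargeMatchedChargeKernelBounds` DISCHARGED for
# `K := ∇_e G`, `G = latticeGreen` on `ℤ³`, from the PROVED lit bounds of `LatticeGreenGradient`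

Cell `ym3-torus` (YM ladder rung R3 = continuum SU(2) Yang–Mills on the three-torus — a RUNG, NOT the Clay problem); TWIN-WIDTH helper seat
`ym-ust-19936-w8` gen 8; `--supports stmt-QuantumFields-19936` (helper; LOCATE-B5-Z3-COMMUTATOR-w8g8 (19936 evidence #47) §6, the instantiation half
of (Z-c)).  THEOREMS ONLY (0 `def`, default heartbeats).

WHY.  ✓p713769 `CovariantDischargeMatchedChargeKernelBounds` bounds the far field, the dyadic-shell sums and the near `ℓ¹` mass of `K ∗ ω` for a
mean-zero charge `ω` on `ℤ³` under two HYPOTHESES on the kernel `K`, stated in the sup-norm `box` language of lit ✓`B4Eq19LatticeOperators`: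
(H1) `|K w| ≤ C₁∕n²` for `w ∉ box 0 (n−1)`, `n ≥ 1`;  (H2) `|K(w + e_i) − K w| ≤ C₂∕n³` for `w ∉ box 0 (n−1)`, `n ≥ 2`.  The knit of B5 takes
`K := K_e`, `K_e(w) := G(w + e_e) − G(w)` (`G = latticeGreen`, twice the Green function of `−Δ_{ℤ³}`; lit ✓`LatticeGreenPoisson`).  THIS FILE proves
(H1) and (H2) for `K_e` in `d = 3` from the Euclidean-norm bounds PROVED in lit ✓`LatticeGreenGradient`:
✓`latticeGreen_gradient_bound` (`|G(x+eᵢ) − G(x)| ≤ K′|x|^{1−d}`, Lawler 1991 Thm 1.5.5 (1.36)) and ✓`latticeGreen_second_diff_bound`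
(`|G(x+eⱼ+eᵢ) − G(x+eⱼ) − G(x+eᵢ) + G(x)| ≤ K₃|x|^{−d}`), via `‖w‖_∞ ≤ |w|₂`:
* §1 `le_sqrt_sum_sq_of_not_mem_box` (`w ∉ box 0 (n−1)` ⇒ `n ≤ |w|₂`), `ne_zero_of_not_mem_box`, `add_unitVec_ne_zero_of_not_mem_box`,
  `rpow_one_sub_three_le` ∕ `rpow_neg_three_le` (`|w|^{1−3} ≤ 1∕n²`, `|w|^{−3} ≤ 1∕n³` when `n ≤ |w|`);
* §2 ★★ `exists_fdiff_latticeGreen_box_bounds` — **there are `C₁, C₂ ≥ 0` such that for every direction `e`, (H1) and (H2) hold for `K_e`**.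
So, with ✓p713769: every real charge `ω` on `box p ℓ` with `Σω = 0` has a potential `G ∗ ω` whose first differences obey the dipole far-field law
`|∇_e(G∗ω)(x)| ≤ 8C₂M₁∕N³` off `box p (N−1)` (`N ≥ 2ℓ+2`), dyadic-shell sums `≤ 1000·C₂·M₁`, and near `ℓ¹` mass `≤ (|K_e 0| + 26C₁(N+ℓ))·Σ|ω|`.
HONEST SCOPE.  Norm bookkeeping over two lit theorems; nothing here proves B5, the capped stub, `HistoryTailL` or any summit statement; YM₃ on T³ is
rung R3, not Clay. [folklore] (the kernel bounds themselves: G. F. Lawler, *Intersections of Random Walks* (1991), Thm 1.5.5 — lit, cited there).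
-/

noncomputable section

open scoped BigOperators
open Finset

namespace Summit.QuantumFields.YangMills.Theorems.CovariantDischargeFreeGreenKernelBoxBounds

open Literature.Probability.LatticeModels (latticeGreen latticeGreen_gradient_bound latticeGreen_second_diff_bound)
open Literature.MathematicalPhysics.QuantumFieldTheory.Balaban1983to89.B4Eq19LatticeOperators

/-! ## §1 Sup norm versus Euclidean norm on `ℤ³`, and the `rpow` conversions -/

/-- Outside `box 0 (n−1)` some coordinate has modulus `≥ n`. [folklore] -/
theorem exists_le_abs_of_not_mem_box {d : ℕ} {w : Zd d} {n : ℤ} (hw : w ∉ box (0 : Zd d) (n - 1)) : ∃ i, n ≤ |w i| := by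
  by_contra h
  apply hw
  rw [mem_box]
  intro i
  have : ¬ n ≤ |w i| := fun hi => h ⟨i, hi⟩
  simp only [Pi.zero_apply, sub_zero]
  omega

/-- `w ∉ box 0 (n−1)` ⇒ `n ≤ |w|₂`. [folklore] -/
theorem le_sqrt_sum_sq_of_not_mem_box {d : ℕ} {w : Zd d} {n : ℕ} (hw : w ∉ box (0 : Zd d) ((n : ℤ) - 1)) :
    (n : ℝ) ≤ Real.sqrt (∑ j, ((w j : ℤ) : ℝ) ^ 2) := by
  obtain ⟨i, hi⟩ := exists_le_abs_of_not_mem_box hw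
  have h1 : (n : ℝ) ≤ |((w i : ℤ) : ℝ)| := by
    rw [← Int.cast_abs]; exact_mod_cast hi
  refine h1.trans ?_
  rw [← Real.sqrt_sq_eq_abs]
  exact Real.sqrt_le_sqrt (Finset.single_le_sum (f := fun j => ((w j : ℤ) : ℝ) ^ 2) (fun j _ => sq_nonneg _) (Finset.mem_univ i))

/-- `w ∉ box 0 (n−1)` with `n ≥ 1` ⇒ `w ≠ 0`. [folklore] -/
theorem ne_zero_of_not_mem_box {d : ℕ} {w : Zd d} {n : ℤ} (hn : 1 ≤ n) (hw : w ∉ box (0 : Zd d) (n - 1)) : w ≠ 0 := by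
  rintro rfl
  exact hw (self_mem_box 0 (by omega))

/-- `w ∉ box 0 (n−1)` with `n ≥ 2` ⇒ `w + e_i ≠ 0`. [folklore] -/
theorem add_unitVec_ne_zero_of_not_mem_box {d : ℕ} {w : Zd d} {n : ℤ} (hn : 2 ≤ n) (hw : w ∉ box (0 : Zd d) (n - 1)) (i : Fin d) :
    w + unitVec i ≠ 0 := by
  intro h
  apply hw
  rw [mem_box]
  intro j
  have hj : (w + unitVec i) j = 0 := by rw [h]; rfl
  simp only [Pi.add_apply] at hj
  have hu := abs_unitVec_apply_le i j
  simp only [Pi.zero_apply, sub_zero]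
  have : |w j| ≤ 1 := by
    have : w j = -(unitVec i j) := by linarith
    rw [this, abs_neg]; exact hu
  omega

/-- `n ≤ r`, `n ≥ 1` ⇒ `r^{1−3} ≤ 1∕n²` (real powers). [folklore] -/
theorem rpow_one_sub_three_le {r : ℝ} {n : ℕ} (hn : 1 ≤ n) (hr : (n : ℝ) ≤ r) : r ^ (1 - (3 : ℝ)) ≤ 1 / (n : ℝ) ^ 2 := by
  have hn0 : (0 : ℝ) < n := by exact_mod_cast hn
  have hr0 : 0 < r := hn0.trans_le hr
  rw [show (1 - (3 : ℝ)) = -(2 : ℝ) by norm_num, Real.rpow_neg hr0.le, show (2 : ℝ) = ((2 : ℕ) : ℝ) by norm_num, Real.rpow_natCast,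
    one_div]
  exact inv_anti₀ (by positivity) (pow_le_pow_left₀ hn0.le hr 2)

/-- `n ≤ r`, `n ≥ 1` ⇒ `r^{−3} ≤ 1∕n³` (real powers). [folklore] -/
theorem rpow_neg_three_le {r : ℝ} {n : ℕ} (hn : 1 ≤ n) (hr : (n : ℝ) ≤ r) : r ^ (-(3 : ℝ)) ≤ 1 / (n : ℝ) ^ 3 := by
  have hn0 : (0 : ℝ) < n := by exact_mod_cast hn
  have hr0 : 0 < r := hn0.trans_le hr
  rw [Real.rpow_neg hr0.le, show (3 : ℝ) = ((3 : ℕ) : ℝ) by norm_num, Real.rpow_natCast, one_div]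
  exact inv_anti₀ (by positivity) (pow_le_pow_left₀ hn0.le hr 3)

/-! ## §2 (H1) and (H2) for the forward differences of the free Green kernel on `ℤ³` -/

/-- ★★ **THE FREE GREEN KERNEL'S DIFFERENCE BOUNDS IN BOX LANGUAGE (`d = 3`).**  There are `C₁, C₂ ≥ 0` such that for every direction `e`
the kernel `K_e(w) := G(w + e_e) − G(w)` (`G = latticeGreen` on `ℤ³`) satisfies
(H1) `|K_e(w)| ≤ C₁∕n²` whenever `w ∉ box 0 (n−1)`, `n ≥ 1`, and
(H2) `|K_e(w + e_i) − K_e(w)| ≤ C₂∕n³` whenever `w ∉ box 0 (n−1)`, `n ≥ 2`, for every `i`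
— exactly the hypotheses of ✓`CovariantDischargeMatchedChargeKernelBounds` (`abs_sum_mul_le_of_decay`, `shell_sum_far_field_le` with `q = 3`;
`sum_box_abs_le_of_decay`, `sum_box_abs_sum_mul_le`).  [folklore] (from lit ✓`latticeGreen_gradient_bound`, ✓`latticeGreen_second_diff_bound`,
which carry the citation of Lawler 1991, Thm 1.5.5) -/
theorem exists_fdiff_latticeGreen_box_bounds : ∃ C₁ C₂ : ℝ, 0 ≤ C₁ ∧ 0 ≤ C₂ ∧ ∀ e : Fin 3,
    (∀ (w : Zd 3) (n : ℕ), 1 ≤ n → w ∉ box (0 : Zd 3) ((n : ℤ) - 1) →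
      |latticeGreen (w + unitVec e) - latticeGreen w| ≤ C₁ / (n : ℝ) ^ 2) ∧
    (∀ (w : Zd 3) (n : ℕ), 2 ≤ n → w ∉ box (0 : Zd 3) ((n : ℤ) - 1) → ∀ i : Fin 3,
      |(latticeGreen (w + unitVec i + unitVec e) - latticeGreen (w + unitVec i)) - (latticeGreen (w + unitVec e) - latticeGreen w)| ≤
        C₂ / (n : ℝ) ^ 3) := by
  obtain ⟨K', hK'0, hK'⟩ := latticeGreen_gradient_bound (d := 3) le_rfl
  obtain ⟨K₃, hK₃0, hK₃⟩ := latticeGreen_second_diff_bound (d := 3) le_rfl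
  refine ⟨K', K₃, hK'0, hK₃0, fun e => ⟨fun w n hn hw => ?_, fun w n hn hw i => ?_⟩⟩
  · -- (H1)
    have hw0 : w ≠ 0 := ne_zero_of_not_mem_box (by exact_mod_cast hn) hw
    have hr := le_sqrt_sum_sq_of_not_mem_box hw
    have h := hK' w hw0 e
    rw [unitVec]
    refine h.trans ?_
    have : Real.sqrt (∑ j, ((w j : ℤ) : ℝ) ^ 2) ^ (1 - ((3 : ℕ) : ℝ)) ≤ 1 / (n : ℝ) ^ 2 := by
      rw [show ((3 : ℕ) : ℝ) = (3 : ℝ) by norm_num]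
      exact rpow_one_sub_three_le hn hr
    calc K' * Real.sqrt (∑ j, ((w j : ℤ) : ℝ) ^ 2) ^ (1 - ((3 : ℕ) : ℝ)) ≤ K' * (1 / (n : ℝ) ^ 2) :=
          mul_le_mul_of_nonneg_left this hK'0
      _ = K' / (n : ℝ) ^ 2 := by ring
  · -- (H2)
    have hn1 : (1 : ℤ) ≤ n := by exact_mod_cast (show 1 ≤ n by omega)
    have hw0 : w ≠ 0 := ne_zero_of_not_mem_box hn1 hw
    have hwi : w + Pi.single i 1 ≠ 0 := add_unitVec_ne_zero_of_not_mem_box (by exact_mod_cast hn) hw i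
    have hr := le_sqrt_sum_sq_of_not_mem_box hw
    have h := hK₃ w hw0 e i hwi
    simp only [unitVec]
    rw [show latticeGreen (w + Pi.single i 1 + Pi.single e 1) - latticeGreen (w + Pi.single i 1) -
        (latticeGreen (w + Pi.single e 1) - latticeGreen w) =
        latticeGreen (w + Pi.single i 1 + Pi.single e 1) - latticeGreen (w + Pi.single i 1) -
        latticeGreen (w + Pi.single e 1) + latticeGreen w by ring]
    refine h.trans ?_
    have : Real.sqrt (∑ j, ((w j : ℤ) : ℝ) ^ 2) ^ (-((3 : ℕ) : ℝ)) ≤ 1 / (n : ℝ) ^ 3 := by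
      rw [show ((3 : ℕ) : ℝ) = (3 : ℝ) by norm_num]
      exact rpow_neg_three_le (by omega) hr
    calc K₃ * Real.sqrt (∑ j, ((w j : ℤ) : ℝ) ^ 2) ^ (-((3 : ℕ) : ℝ)) ≤ K₃ * (1 / (n : ℝ) ^ 3) :=
          mul_le_mul_of_nonneg_left this hK₃0
      _ = K₃ / (n : ℝ) ^ 3 := by ring

end Summit.QuantumFields.YangMills.Theorems.CovariantDischargeFreeGreenKernelBoxBounds

end
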